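import Literature.Probability.Percolation.LinkSemantics
import Literature.Probability.Percolation.QuadCrossingPushforward
import Literature.Probability.Percolation.QuadCrossingRotationInvariance
import HarnessLib

/-!
# The link quad of a tile domain in the plane, and its crossing event

Topic `Probability/Percolation`.  Ninth step of the cell-complex toolkit for the gluing theorem
(Schramm–Smirnov 2011, proof of Thm 1.5, step (C)).  The cell complexes of `TileDomain.lean` live
in cell coordinates (the vertex `v` of `ℤ²` at the centre of its site cell `σ v = 2v`); the
percolation drawing of the tree at mesh `δ` puts `v` at `meshPoint δ v = δ v`.  The affine
homeomorphism `cellScale δ : z ↦ (δ/2)(z - (½ + ½ i))` matches the two: it maps cell centres to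
mesh points (`cellScale_ctr_σc`), drawn edges to drawn edges (`image_cellSeg`) and the open drawing
`drawnC ω` onto `openEdgeUnion δ ω` (`image_drawnC`).

* `linkQuad` — the quad of `D` obtained from an edge-connected pinch-free hole-free cell set `U`
  with four marked traced vertices (`CellQuad.exists_cellQuad`) by `Quad.mapDomain` along
  `cellScale δ`; `carrier_linkQuad`, `side_linkQuad`;
* `mem_z2QuadConfig_linkQuad_iff` — **the crossing event of the link quad is the docking-walk
  event**: `linkQuad ∈ z2QuadConfig D δ ω` iff there are open contact darts whose contact points lie
  on the arcs carried to `∂₀` and `∂₂`, with exactly one cell of each contact side in `U`, joined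
  by a chain of open steps through sites of the domain (`LinkSemantics.lean`), provided `U` has no
  slits (e.g. `U = 𝒯.U`, `TileData.βc_mem_of_σc_mem`).

Everything is proved; no named fact is introduced.

## References

* O. Schramm, S. Smirnov, Ann. Probab. 39 (2011), arXiv:1101.5820, §1.3 and proof of Thm 1.5 (C). [SchrammSmirnov2011]
-/

noncomputable section

open Set Metric Relation
open Literature.Probability.LatticeModels
open Literature.Probability.RandomPlanarGeometry

namespace Literature.Probability.Percolation

namespace CellComplex

/-! ### The affine change of coordinates -/

/-- The centre offset `½ + ½ i`. [folklore] -/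
def c₀ : ℂ := ⟨1 / 2, 1 / 2⟩

/-- **Cell coordinates to plane coordinates at mesh `δ`**: `z ↦ (δ/2)(z - (½ + ½ i))`. [folklore] -/
def cellScale (δ : ℝ) (hδ : 0 < δ) : ℂ ≃ₜ ℂ :=
  (Homeomorph.addRight (-c₀)).trans
    (Homeomorph.mulLeft₀ ((δ / 2 : ℝ) : ℂ) (by exact_mod_cast (by positivity : (δ / 2 : ℝ) ≠ 0)))

variable {δ : ℝ} (hδ : 0 < δ)

/-- The formula. [folklore] -/
theorem cellScale_apply (z : ℂ) : cellScale δ hδ z = ((δ / 2 : ℝ) : ℂ) * (z - c₀) := by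
  simp [cellScale, sub_eq_add_neg]

/-- **Cell centres go to mesh points.** [folklore] -/
theorem cellScale_ctr_σc (v : Site 2) : cellScale δ hδ (ctr (σc v)) = meshPoint δ v := by
  rw [cellScale_apply, meshPoint]
  have : ctr (σc v) - c₀ = 2 * Site.toComplex v := by
    apply Complex.ext <;> simp [ctr_re, ctr_im, σc_apply, c₀, two_mul]
  rw [this]; push_cast; ring

/-- `cellScale` is affine: it commutes with `lineMap`. [folklore] -/
theorem cellScale_lineMap (p q : ℂ) (t : ℝ) :
    cellScale δ hδ (AffineMap.lineMap p q t) = AffineMap.lineMap (cellScale δ hδ p) (cellScale δ hδ q) t := by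
  simp only [cellScale_apply, AffineMap.lineMap_apply_module', Complex.real_smul]
  ring

/-- `cellScale` maps segments to segments. [folklore] -/
theorem image_segment_cellScale (p q : ℂ) :
    cellScale δ hδ '' segment ℝ p q = segment ℝ (cellScale δ hδ p) (cellScale δ hδ q) := by
  rw [segment_eq_image_lineMap, segment_eq_image_lineMap, ← image_comp]
  refine image_congr fun t _ => ?_
  exact cellScale_lineMap hδ p q t

/-- **Drawn edges go to drawn edges.** [folklore] -/
theorem image_cellSeg (x : Site 2) (k : Fin 4) :
    cellScale δ hδ '' cellSeg x k = segment ℝ (meshPoint δ x) (meshPoint δ (x + cornerUnit k)) := by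
  rw [cellSeg_eq_segment, image_segment_cellScale, cellScale_ctr_σc, cellScale_ctr_σc]

/-- Adjacency in `ℤ²` in dart form. [folklore] -/
theorem adj_iff_exists_cornerUnit {x y : Site 2} : (zdGraph 2).Adj x y ↔ ∃ k : Fin 4, y = x + cornerUnit k := by
  constructor
  · intro h
    have he : s(x, y) ∈ (zdGraph 2).edgeSet := h
    obtain ⟨k, hk⟩ := exists_eq_dartEdge_of_mem he (Sym2.mem_mk_left x y)
    exact ⟨k, eq_add_cornerUnit_of_mk_eq_dartEdge he hk⟩
  · rintro ⟨k, rfl⟩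
    exact (SimpleGraph.mem_edgeSet _).1 (dartEdge_mem_edgeSet x k)

/-- **The open drawing goes to the open drawing.** [folklore] -/
theorem image_drawnC (ω : BondConfig (Site 2)) : cellScale δ hδ '' drawnC ω = openEdgeUnion δ ω := by
  ext z
  simp only [mem_image, mem_drawnC_iff, mem_openEdgeUnion_iff]
  constructor
  · rintro ⟨p, ⟨x, k, hk, hp⟩, rfl⟩
    refine ⟨x, x + cornerUnit k, adj_iff_exists_cornerUnit.2 ⟨k, rfl⟩, hk, ?_⟩
    rw [← image_cellSeg hδ]; exact ⟨p, hp, rfl⟩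
  · rintro ⟨x, y, hadj, hω, hz⟩
    obtain ⟨k, rfl⟩ := adj_iff_exists_cornerUnit.1 hadj
    rw [← image_cellSeg hδ] at hz
    obtain ⟨p, hp, rfl⟩ := hz
    exact ⟨p, ⟨x, k, hω, hp⟩, rfl⟩

/-! ### The link quad -/

section LinkQuad

variable {U : Finset (Site 2)} {d₀ : Site 2 × Fin 4} (h₀ : IsBd U d₀) (hP : PinchFree U) (hE : EdgeConn U)
  (hH : CoHoleFree U) (a : Fin 4 → ℕ) (hmono : StrictMono a) (ha3 : a 3 < period h₀)
  {D : Set ℂ}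

/-- The cell-coordinate domain `cellScale⁻¹ D` contains `K`. [folklore] -/
theorem Kset_subset_preimage (hD : cellScale δ hδ '' Kset U ⊆ D) : Kset U ⊆ cellScale δ hδ ⁻¹' D :=
  fun p hp => hD ⟨p, hp, rfl⟩

/-- The image of the cell-coordinate domain is `D`. [folklore] -/
theorem image_preimage_cellScale (D : Set ℂ) : cellScale δ hδ '' (cellScale δ hδ ⁻¹' D) = D :=
  image_preimage_eq D (cellScale δ hδ).surjective

/-- **The link quad**: the cell quad with the four marked traced vertices, carried to the plane at
mesh `δ`. [cite: SchrammSmirnov2011, proof of Thm 1.5 (C)] -/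
def linkQuad (hD : cellScale δ hδ '' Kset U ⊆ D) : QuadCrossing.Quad D :=
  (Classical.choose (exists_cellQuad h₀ hP hE hH a hmono ha3 (Kset_subset_preimage hδ hD))).mapDomain
    (QuadCrossing.DomainHomeomorph.ofHomeomorph (cellScale δ hδ) (image_preimage_cellScale hδ D))

/-- The carrier of the link quad. [folklore] -/
theorem carrier_linkQuad (hD : cellScale δ hδ '' Kset U ⊆ D) :
    (linkQuad hδ h₀ hP hE hH a hmono ha3 hD).carrier = cellScale δ hδ '' Kset U := by
  rw [linkQuad, QuadCrossing.Quad.carrier_mapDomain,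
    (Classical.choose_spec (exists_cellQuad h₀ hP hE hH a hmono ha3 (Kset_subset_preimage hδ hD))).1]
  rfl

/-- The sides of the link quad: `side k` is the image of the arc `k + 3` of the marked cell
complex. [folklore] -/
theorem side_linkQuad (hD : cellScale δ hδ '' Kset U ⊆ D) (k : Fin 4) :
    (linkQuad hδ h₀ hP hE hH a hmono ha3 hD).side k = cellScale δ hδ '' (cellRect h₀ hP a hmono ha3).arc (k + 3) := by
  rw [linkQuad, QuadCrossing.Quad.side_mapDomain,
    (Classical.choose_spec (exists_cellQuad h₀ hP hE hH a hmono ha3 (Kset_subset_preimage hδ hD))).2 k]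
  rfl

/-- The arcs of the marked cell complex lie on the frontier of `K`. [folklore] -/
theorem arc_subset_frontier_Kset (hE : EdgeConn U) (hH : CoHoleFree U) (k : Fin 4) :
    (cellRect h₀ hP a hmono ha3).arc k ⊆ frontier (Kset U) := by
  intro p hp
  have hfr : p ∈ frontier (cellRect h₀ hP a hmono ha3).carrier := MarkedDomain.arc_subset_frontier _ k hp
  have hpr : p ∈ range (bdLoop U d₀ h₀) := by rw [← frontier_cellDomain h₀ hP]; exact hfr
  obtain ⟨i, -, hpi⟩ := exists_edge_of_mem_range h₀ hpr
  rw [frontier, (isClosed_Kset U).closure_eq]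
  refine ⟨?_, fun hint => Set.disjoint_left.1 (interior_Kset_disjoint_edgeSeg (isBd_bdOrbit h₀ i)) hint hpi⟩
  rw [← closure_carrier_cellDomain h₀ hP hE hH]
  exact frontier_subset_closure hfr

/-- **The crossing event of the link quad is the docking-walk event** (see the module docstring).
[cite: SchrammSmirnov2011, proof of Thm 1.5 (C)] -/
theorem mem_z2QuadConfig_linkQuad_iff (hD : cellScale δ hδ '' Kset U ⊆ D)
    (hslit : ∀ x k, σc x ∈ U → σc (x + cornerUnit k) ∈ U → βc x k ∈ U)
    (hinner : ∀ x k, σc x ∉ U → βc x k ∈ U → σc (x + cornerUnit k) ∈ U) (ω : BondConfig (Site 2)) :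
    linkQuad hδ h₀ hP hE hH a hmono ha3 hD ∈ z2QuadConfig D δ ω ↔
      ∃ (x : Site 2) (k : Fin 4) (x' : Site 2) (k' : Fin 4),
        dartEdge x k ∈ ω ∧ dartEdge x' k' ∈ ω ∧
        cpt x k ∈ (cellRect h₀ hP a hmono ha3).arc 3 ∧ cpt x' k' ∈ (cellRect h₀ hP a hmono ha3).arc 1 ∧
        ((σc x ∈ U ∧ βc x k ∉ U) ∨ (σc x ∉ U ∧ βc x k ∈ U)) ∧
        ((σc x' ∈ U ∧ βc x' k' ∉ U) ∨ (σc x' ∉ U ∧ βc x' k' ∈ U)) ∧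
        ReflTransGen (OpenStep U ω) (innerSite U x k) (innerSite U x' k') := by
  set Q := linkQuad hδ h₀ hP hE hH a hmono ha3 hD with hQ
  set ψ := cellScale δ hδ with hψ
  rw [QuadCrossing.mem_z2QuadConfig_iff_exists_isCrossing hδ]
  have hside0 : Q.side 0 = ψ '' (cellRect h₀ hP a hmono ha3).arc 3 := side_linkQuad hδ h₀ hP hE hH a hmono ha3 hD 0
  have hside2 : Q.side 2 = ψ '' (cellRect h₀ hP a hmono ha3).arc 1 := by
    rw [side_linkQuad hδ h₀ hP hE hH a hmono ha3 hD 2]; rfl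
  have hcar : Q.carrier = ψ '' Kset U := carrier_linkQuad hδ h₀ hP hE hH a hmono ha3 hD
  constructor
  · rintro ⟨K, ⟨-, hKconn, hKQ, hK0, hK2⟩, hKO⟩
    -- pull back to cell coordinates
    set C := ψ.symm '' K with hC
    have hCsub : C ⊆ Kset U := by
      rintro _ ⟨z, hz, rfl⟩
      obtain ⟨p, hp, hpz⟩ := (hcar ▸ hKQ hz : z ∈ ψ '' Kset U)
      rw [← hpz, Homeomorph.symm_apply_apply]; exact hp
    have hCO : C ⊆ drawnC ω := by
      rintro _ ⟨z, hz, rfl⟩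
      have := hKO hz
      rw [← image_drawnC hδ] at this
      obtain ⟨p, hp, hpz⟩ := this
      rw [← hpz, Homeomorph.symm_apply_apply]; exact hp
    have hCconn : IsConnected C := hKconn.image _ ψ.symm.continuous.continuousOn
    have pull : ∀ {A : Set ℂ}, (K ∩ ψ '' A).Nonempty → (C ∩ A).Nonempty := by
      rintro A ⟨z, hzK, p, hpA, rfl⟩
      exact ⟨p, ⟨ψ p, hzK, ψ.symm_apply_apply p⟩, hpA⟩
    rw [hside0] at hK0
    rw [hside2] at hK2
    obtain ⟨x, k, x', k', hk, hk', ⟨-, h0⟩, ⟨-, h2⟩, hs, hs', hchain⟩ :=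
      exists_chain_of_connected hCconn hCO hCsub (arc_subset_frontier_Kset h₀ hP a hmono ha3 hE hH 3)
        (arc_subset_frontier_Kset h₀ hP a hmono ha3 hE hH 1) (pull hK0) (pull hK2)
    exact ⟨x, k, x', k', hk, hk', h0, h2, hs, hs',
      hchain _ (innerSite_mem U x k) (innerSite_spec hinner hs).1 _ (innerSite_mem U x' k') (innerSite_spec hinner hs').1⟩
  · rintro ⟨x, k, x', k', hk, hk', h0, h2, hs, hs', hchain⟩
    obtain ⟨hbU, hseg⟩ := innerSite_spec hinner hs
    obtain ⟨hb'U, hseg'⟩ := innerSite_spec hinner hs'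
    obtain ⟨K, hKc, hKconn, hKO, hKK, hcK, hcK'⟩ :=
      exists_connected_of_chain hslit hk hk' (innerSite_mem U x k) (innerSite_mem U x' k') hseg hseg' hchain
    refine ⟨ψ '' K, ⟨hKc.image ψ.continuous, hKconn.image _ ψ.continuous.continuousOn, ?_, ?_, ?_⟩, ?_⟩
    · rw [hcar]; exact image_mono hKK
    · rw [hside0]; exact ⟨ψ (cpt x k), ⟨_, hcK, rfl⟩, ⟨_, h0, rfl⟩⟩
    · rw [hside2]; exact ⟨ψ (cpt x' k'), ⟨_, hcK', rfl⟩, ⟨_, h2, rfl⟩⟩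
    · rw [← image_drawnC hδ]; exact image_mono hKO

end LinkQuad

end CellComplex

end Literature.Probability.Percolation

end
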